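import Summits.HodgeConjecture.HodgeConjecture.Theses.HeckePrymWeil
import Literature.AlgebraicGeometry.HodgeTheory.RationalClassesIndependent
import Literature.AlgebraicGeometry.HodgeTheory.SupportedClassesRational

/-!
# `AimedDescending` (stmt-HodgeConjecture-14643) · II · hyperbolic Weil type from an abstract rational model

Route `HeckePrymWeil`, support item `AimedDescending`. The aimed-partner input (P) of
`Theorems/HeckePrymWeilAimedDescending` ends, in print, with a piece of pure linear algebra: once the
rational cohomology `H¹((A × B)(ℂ); ℚ)` is written in a rational frame `u₁, …, u_r` in which
`(φ × ψ)^*` has a rational matrix `M` and the polarization pairing `Q_h(x, y) = h^{2N-1} ⌣ (x ⌣ y)`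
has a rational Gram matrix `G` (times a fixed top class `ω`), Landherr's theorem — in the tree:
Meyer + `Motives/WeilHermitianSplitting` — produces `2N` rational coefficient vectors spanning an
`M`-stable, `G`-isotropic `ℚ`-subspace, and THAT is a hyperbolic frame
(`Motives.IsHyperbolicWeilType`, van Geemen 1994, 5.2 (2)–(3), 5.4). This file PROVES this last
transport step on the real carriers, for every `(X, Φ, N, h)`:

* `isHyperbolicWeilType_of_rationalModel` — given rational, `ℂ`-independent classes
  `u : ι → H¹(X(ℂ); ℂ)`, a rational matrix `M` with `Φ^* uᵢ = Σⱼ M j i • uⱼ`, a rational matrix `G`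
  and a class `ω` with `Q_h(uᵢ, uⱼ) = G i j • ω`, and `ℚ`-independent coefficient vectors
  `b : Fin (2N) → (ι → ℚ)` whose span is `M`-stable and which are pairwise `G`-isotropic, the
  classes `v_k = Σᵢ b k i • uᵢ` form a hyperbolic frame: `IsHyperbolicWeilType X Φ N h`.

Ingredients (all proved in the tree): rational combinations of rational classes are rational
(`IsRationalClass.sum_smul`); `ℂ`-independence of rational classes is the absence of rational
relations (`linearIndependent_iff_of_isRationalClass`, Hatcher §3.1: `Hᵏ(ℚ) ⊗ ℂ ↪ Hᵏ(ℂ)`);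
bilinearity of `polarizationPairingOne`.
-/

noncomputable section

-- every declaration of this problem lives in `Summit.HodgeConjecture.HodgeConjecture.…`
set_option linter.dupNamespace false

open CategoryTheory
open Literature.AlgebraicGeometry Literature.AlgebraicGeometry.HodgeTheory
open Literature.AlgebraicTopology.SingularHomology

namespace Summit.HodgeConjecture.HodgeConjecture.Theorems

variable {X : Motives.AbelianVariety ℂ} {Φ : X ⟶ X} {N : ℕ} {h : complexBetti X.X 2}
  {ι : Type*} [Fintype ι]

/-- Re-indexing a rational combination of a frame: `Σ_k q_k • (Σ_i b_{k,i} • u_i) = Σ_i (Σ_k q_k b_{k,i}) • u_i`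
(casts from `ℚ` to `ℂ` pushed through). [folklore] -/
theorem sum_smul_sum_smul_eq {κ : Type*} [Fintype κ] (u : ι → complexBetti X.X 1)
    (b : κ → ι → ℚ) (q : κ → ℂ) :
    ∑ k, q k • ∑ i, ((b k i : ℚ) : ℂ) • u i = ∑ i, (∑ k, q k * ((b k i : ℚ) : ℂ)) • u i := by
  simp_rw [Finset.smul_sum, smul_smul, Finset.sum_smul]
  rw [Finset.sum_comm]

/-- Expanding a bilinear map on two finite combinations of a frame:
`B (Σ_i a_i • u_i) (Σ_j c_j • u_j) = Σ_i Σ_j (a_i c_j) • B u_i u_j`. [folklore] -/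
theorem bilin_sum_smul_sum_smul {V W : Type*} [AddCommGroup V] [Module ℂ V] [AddCommGroup W]
    [Module ℂ W] (B : V →ₗ[ℂ] V →ₗ[ℂ] W) (a c : ι → ℂ) (u : ι → V) :
    B (∑ i, a i • u i) (∑ j, c j • u j) = ∑ i, ∑ j, (a i * c j) • B (u i) (u j) := by
  have h1 : ∀ j, B (∑ i, a i • u i) (c j • u j) = ∑ i, (a i * c j) • B (u i) (u j) := by
    intro j
    rw [LinearMap.map_smul, map_sum, LinearMap.sum_apply, Finset.smul_sum]
    refine Finset.sum_congr rfl fun i _ => ?_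
    rw [LinearMap.map_smul, LinearMap.smul_apply, smul_smul, mul_comm]
  rw [map_sum]
  simp_rw [h1]
  rw [Finset.sum_comm]

/-- **Hyperbolic Weil type from an abstract rational model** (the transport step of the aimed
partner (P); van Geemen 1994, 5.2 (2)–(3) and 5.4 (5.4.1): "`H₁(X, ℚ)` contains a `K`-stable
Lagrangian `ℚ`-subspace of dimension `2n`" read in coordinates). Let `u : ι → H¹(X(ℂ); ℂ)` be
rational and `ℂ`-linearly independent, `M` a rational matrix with `Φ^* uᵢ = Σⱼ M j i • uⱼ`
(`Φ^*` is rational in the frame), `G` a rational matrix and `ω` a class with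
`Q_h(uᵢ, uⱼ) = h^{2N-1} ⌣ (uᵢ ⌣ uⱼ) = G i j • ω` (the Gram matrix of the polarization pairing in the
frame), and `b : Fin (2N) → (ι → ℚ)` rational coefficient vectors which are `ℚ`-linearly
independent, span an `M`-stable subspace (`M · b_k = Σ_l c_l b_l`) and are pairwise `G`-isotropic
(`b_kᵀ G b_l = 0`). Then the classes `v_k = Σᵢ b k i • uᵢ` are rational, `ℂ`-independent, span a
`Φ^*`-stable subspace and are pairwise `Q_h`-isotropic: `(X, Φ)` is of hyperbolic Weil type in
half-dimension `N` for `h`. -/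
theorem isHyperbolicWeilType_of_rationalModel (u : ι → complexBetti X.X 1)
    (hu : ∀ i, IsRationalClass (u i)) (hind : LinearIndependent ℂ u) (M : Matrix ι ι ℚ)
    (hM : ∀ i, complexBetti.map Φ.hom.hom.hom 1 (u i) = ∑ j, ((M j i : ℚ) : ℂ) • u j)
    (G : Matrix ι ι ℚ) (ω : complexBetti X.X (2 + 2 * (2 * N - 1)))
    (hG : ∀ i j, Motives.polarizationPairingOne X.X h (2 * N - 1) (u i) (u j) = ((G i j : ℚ) : ℂ) • ω)
    (b : Fin (2 * N) → ι → ℚ) (hb : LinearIndependent ℚ b)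
    (hbM : ∀ k, ∃ c : Fin (2 * N) → ℚ, M.mulVec (b k) = ∑ l, c l • b l)
    (hbG : ∀ k l, ∑ i, ∑ j, b k i * G i j * b l j = 0) :
    Motives.IsHyperbolicWeilType X Φ N h := by
  classical
  -- the frame
  set v : Fin (2 * N) → complexBetti X.X 1 := fun k => ∑ i, ((b k i : ℚ) : ℂ) • u i with hv
  have hv_rat : ∀ k, IsRationalClass (v k) := fun k => IsRationalClass.sum_smul Finset.univ hu (b k)
  refine ⟨v, hv_rat, ?_, ?_, ?_⟩
  · -- `ℂ`-independence: a rational relation among the `v_k` is one among the `u_i`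
    rw [linearIndependent_iff_of_isRationalClass hv_rat]
    intro q hq
    have hu' := (linearIndependent_iff_of_isRationalClass hu).1 hind
    have h1 : ∑ i, ((∑ k, q k * b k i : ℚ) : ℂ) • u i = 0 := by
      rw [← hq, hv, sum_smul_sum_smul_eq]
      simp only [Rat.cast_sum, Rat.cast_mul]
    have h2 : (fun i => ∑ k, q k * b k i) = 0 := hu' _ h1
    -- `Σ_k q_k b_k = 0` in `ι → ℚ`, so `q = 0` by the `ℚ`-independence of `b`
    have h3 : ∑ k, q k • b k = 0 := by
      funext i
      simpa [Finset.sum_apply, Pi.smul_apply, smul_eq_mul] using congrFun h2 i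
    exact funext fun k => Fintype.linearIndependent_iff.1 hb q h3 k
  · -- `Φ^*`-stability: `Φ^* v_k = Σ_j (M b_k)_j u_j = Σ_l c_l v_l`
    intro k
    obtain ⟨c, hc⟩ := hbM k
    have h1 : complexBetti.map Φ.hom.hom.hom 1 (v k) = ∑ j, ((M.mulVec (b k) j : ℚ) : ℂ) • u j := by
      simp only [hv, map_sum, map_smul, hM, Finset.smul_sum, smul_smul]
      rw [Finset.sum_comm]
      refine Finset.sum_congr rfl fun j _ => ?_
      rw [← Finset.sum_smul, Matrix.mulVec, dotProduct]
      push_cast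
      simp_rw [mul_comm (((b k _ : ℚ)) : ℂ)]
    have h2 : ∑ j, ((M.mulVec (b k) j : ℚ) : ℂ) • u j = ∑ l, ((c l : ℚ) : ℂ) • v l := by
      rw [hc, hv, sum_smul_sum_smul_eq]
      refine Finset.sum_congr rfl fun j _ => ?_
      congr 1
      simp only [Finset.sum_apply, Pi.smul_apply, smul_eq_mul, Rat.cast_sum, Rat.cast_mul]
    rw [h1, h2]
    exact Submodule.sum_mem _ fun l _ => Submodule.smul_mem _ _ (Submodule.subset_span ⟨l, rfl⟩)
  · -- isotropy: `Q(v_k, v_l) = (b_kᵀ G b_l) • ω = 0`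
    intro k l
    have h1 : Motives.polarizationPairingOne X.X h (2 * N - 1) (v k) (v l) =
        ((∑ i, ∑ j, b k i * G i j * b l j : ℚ) : ℂ) • ω := by
      rw [hv, bilin_sum_smul_sum_smul]
      simp only [hG, smul_smul, Rat.cast_sum, Rat.cast_mul, Finset.sum_smul]
      refine Finset.sum_congr rfl fun i _ => Finset.sum_congr rfl fun j _ => ?_
      ring_nf
    rw [h1, hbG, Rat.cast_zero, zero_smul]

end Summit.HodgeConjecture.HodgeConjecture.Theorems

end
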